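import Summits.ABC.IUTFork.Repair.RHHeightClass
import HarnessLib

/-!
# D-0079 RESCUE sub-cell R-H, row 8 «heightclass» — the per-type SLICE LADDER `k₀(7, e_w, l = 11)` of the declared A6 slice «HEX: k ≤ k₀(p,e_w,l)»,
# KERNEL-EXACT at all eight HEX local types of `I06STAR-COLUMNS` (`ev1 … ev30`), settling abc-iut-rh-ref-2's ERRATA of 2026-08-26T19:41:26Z

PROOF-ONLY companion (D-0012: 0 definitions, 0 `Prop` facts; abc-iut cell, rung LADDER-ABC:A2.RESCUE.H; seat abc-iut-rh-typ-8 gen 3, the row's typer;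
R-H ROUND 2 Q3 input for rh2-q3-num / rh2-q3-typ-1 / rh-kit-1 per `plan/rescue/R-H/ROUND2/START-HERE.md` §2 «reconcile the two ladder entries ref-2 flagged
(row 8: ev3, ev15; table m_q vs k·e_v)») of the typed candidate file `Repair/RHHeightClass.lean` (p459046; author of the candidate abc-iut-lens-strengthen-1).
TAKES NO SIDE on [IUTchIII] Cor. 3.12 or on any author; `HBand` is a claim-tagged HYPOTHESIS; nothing here decides whether a genuine datum lies in the
slice (that is Q3); typed ≠ proved; pure integer arithmetic.

THE LADDER. A HEX local type `evε` has `e_w = 11·ε` over `p = 7` (`ε ∈ {1, 2, 3, 5, 6, 10, 15, 30}`, column `e_v`) and Kummer order `m_q = k·ε` on the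
`λ_k` line; the candidate's certified member valuation is the UNTIED strict minimum `r♯(7, e_w) = min_t (7^t − t·e_w)` (column `r_out_sharp`); at `l = 11`
(`l⋆ = 5`) the top HBand cell reads `24·k·ε ≤ 5·(e_w − r♯) + (1 − r♯)` (`RHHeightClass.hexSlice_iff`, `band_le_of_top`), i.e. `k ≤ k₀ = ⌊(5(e_w − r♯) + 1 − r♯)/(24ε)⌋`:

| type | `e_w` | `r♯` (at `t`) | `5(e_w−r♯)+1−r♯` | `24ε` | `k₀` |
|---|---|---|---|---|---|
| ev1  | 11  | −4 (1)   | 80   | 24  | **3** (`hexSlice_7_11_11`, p459046) |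
| ev2  | 22  | −15 (1)  | 201  | 48  | **4** |
| ev3  | 33  | −26 (1)  | 322  | 72  | **4** (ref-2: 4; the v6 table entry «5» is off by one — `k = 5`: `360 > 322`) |
| ev5  | 55  | −61 (2)  | 642  | 120 | **5** |
| ev6  | 66  | −83 (2)  | 829  | 144 | **5** |
| ev10 | 110 | −171 (2) | 1577 | 240 | **6** |
| ev15 | 165 | −281 (2) | 2512 | 360 | **6** (ref-2: 6; the v6 table entry «7» is off by one — `k = 7`: `2520 > 2512`) |
| ev30 | 330 | −647 (3) | 5533 | 720 | **7** (`hexSlice_7_330_11`, p459046) |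

Each row below is a theorem `strictMinPow_7_⟨e_w⟩` (the certificate that `r♯` IS the strict minimum — so by §T2 `exists_certVal_cell_iff` the typed
`∃ r, CertVal ∧ cell r` IS the cell at `r♯`) and a theorem `hexSlice_7_⟨e_w⟩_11` («`∀ k ≤ k₀`, cell» ∧ «¬ cell at `k₀ + 1`»; monotone in `k`, so this is the
exact threshold), plus `bandCell_int_iff` (the ℝ-valued cell of `HBand` at integer data IS the ℤ cell). abc-iut-rh-ref-2's closed-form values
(Probe-row8.lean, 19:41:26Z) are CONFIRMED at all eight types: the two flagged v6-table entries (ev3 → 5, ev15 → 7) are NOT values of the closed form.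
[claim: Mochizuki2012, status: disputed] for the candidate's reading; the arithmetic is [folklore].
-/

namespace Summit.ABC.IUTFork.Repair.RHHeightClass

/-! ## §L1. The untied strict minima `r♯(7, e_w)` at the six remaining HEX types -/

/-- **`r♯(7, 22) = −15`, UNTIED** (`t = 1`: `7 − 22`; `t = 0, 2`: `1, 5`): HEX type `ev2` (`e_w = 22`), column `r_out_sharp = -15`. [folklore] -/
theorem strictMinPow_7_22 : StrictMinPow 7 22 (-15) := by
  refine ⟨1, by norm_num, fun t' ht' => ?_⟩
  rcases Nat.lt_or_ge t' 3 with h | h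
  · interval_cases t' <;> simp_all
  · obtain ⟨s, rfl⟩ := Nat.exists_eq_add_of_le h
    have h1 : (s : ℤ) + 1 ≤ (7 : ℤ) ^ s := by
      have := Nat.lt_pow_self (show 1 < 7 by norm_num) (n := s)
      exact_mod_cast this
    push_cast
    rw [pow_add]
    nlinarith [h1]

/-- **`r♯(7, 33) = −26`, UNTIED** (`t = 1`: `7 − 33`; `t = 0, 2`: `1, −17`): HEX type `ev3` (`e_w = 33`), column `r_out_sharp = -26`. [folklore] -/
theorem strictMinPow_7_33 : StrictMinPow 7 33 (-26) := by
  refine ⟨1, by norm_num, fun t' ht' => ?_⟩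
  rcases Nat.lt_or_ge t' 3 with h | h
  · interval_cases t' <;> simp_all
  · obtain ⟨s, rfl⟩ := Nat.exists_eq_add_of_le h
    have h1 : (s : ℤ) + 1 ≤ (7 : ℤ) ^ s := by
      have := Nat.lt_pow_self (show 1 < 7 by norm_num) (n := s)
      exact_mod_cast this
    push_cast
    rw [pow_add]
    nlinarith [h1]

/-- **`r♯(7, 55) = −61`, UNTIED** (`t = 2`: `49 − 110`; `t = 0, 1, 3`: `1, −48, 178`): HEX type `ev5` (`e_w = 55`), column `r_out_sharp = -61`. [folklore] -/
theorem strictMinPow_7_55 : StrictMinPow 7 55 (-61) := by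
  refine ⟨2, by norm_num, fun t' ht' => ?_⟩
  rcases Nat.lt_or_ge t' 4 with h | h
  · interval_cases t' <;> simp_all
  · obtain ⟨s, rfl⟩ := Nat.exists_eq_add_of_le h
    have h1 : (s : ℤ) + 1 ≤ (7 : ℤ) ^ s := by
      have := Nat.lt_pow_self (show 1 < 7 by norm_num) (n := s)
      exact_mod_cast this
    push_cast
    rw [pow_add]
    nlinarith [h1]

/-- **`r♯(7, 66) = −83`, UNTIED** (`t = 2`: `49 − 132`; `t = 0, 1, 3`: `1, −59, 145`): HEX type `ev6` (`e_w = 66`), column `r_out_sharp = -83`. [folklore] -/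
theorem strictMinPow_7_66 : StrictMinPow 7 66 (-83) := by
  refine ⟨2, by norm_num, fun t' ht' => ?_⟩
  rcases Nat.lt_or_ge t' 4 with h | h
  · interval_cases t' <;> simp_all
  · obtain ⟨s, rfl⟩ := Nat.exists_eq_add_of_le h
    have h1 : (s : ℤ) + 1 ≤ (7 : ℤ) ^ s := by
      have := Nat.lt_pow_self (show 1 < 7 by norm_num) (n := s)
      exact_mod_cast this
    push_cast
    rw [pow_add]
    nlinarith [h1]

/-- **`r♯(7, 110) = −171`, UNTIED** (`t = 2`: `49 − 220`; `t = 0, 1, 3`: `1, −103, 13`): HEX type `ev10` (`e_w = 110`), column `r_out_sharp = -171`. [folklore] -/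
theorem strictMinPow_7_110 : StrictMinPow 7 110 (-171) := by
  refine ⟨2, by norm_num, fun t' ht' => ?_⟩
  rcases Nat.lt_or_ge t' 4 with h | h
  · interval_cases t' <;> simp_all
  · obtain ⟨s, rfl⟩ := Nat.exists_eq_add_of_le h
    have h1 : (s : ℤ) + 1 ≤ (7 : ℤ) ^ s := by
      have := Nat.lt_pow_self (show 1 < 7 by norm_num) (n := s)
      exact_mod_cast this
    push_cast
    rw [pow_add]
    nlinarith [h1]

/-- **`r♯(7, 165) = −281`, UNTIED** (`t = 2`: `49 − 330`; `t = 0, 1, 3, 4`: `1, −158, −152, 1741`): HEX type `ev15` (`e_w = 165`), column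
`r_out_sharp = -281`. [folklore] -/
theorem strictMinPow_7_165 : StrictMinPow 7 165 (-281) := by
  refine ⟨2, by norm_num, fun t' ht' => ?_⟩
  rcases Nat.lt_or_ge t' 5 with h | h
  · interval_cases t' <;> simp_all
  · obtain ⟨s, rfl⟩ := Nat.exists_eq_add_of_le h
    have h1 : (s : ℤ) + 1 ≤ (7 : ℤ) ^ s := by
      have := Nat.lt_pow_self (show 1 < 7 by norm_num) (n := s)
      exact_mod_cast this
    push_cast
    rw [pow_add]
    nlinarith [h1]

/-! ## §L2. The slice thresholds `k₀(7, e_w, 11)` at the six remaining HEX types (exact: the cell at `k₀` holds, at `k₀ + 1` fails) -/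

/-- **`k₀(7, 22, 11) = 4`** (type `ev2`: `ε = 2`, `r♯ = −15`; `48k ≤ 201` iff `k ≤ 4`: `192 ≤ 201 < 240`). [folklore] -/
theorem hexSlice_7_22_11 :
    (∀ k : ℕ, k ≤ 4 → (((5 : ℤ)) ^ 2 - 1) * ((k : ℤ) * 2) ≤ (5 : ℤ) * ((22 : ℤ) - (-15)) + (1 - (-15))) ∧
      ¬ (((5 : ℤ)) ^ 2 - 1) * ((5 : ℤ) * 2) ≤ (5 : ℤ) * ((22 : ℤ) - (-15)) + (1 - (-15)) := by
  refine ⟨fun k hk => ?_, by norm_num⟩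
  have hk' : (k : ℤ) ≤ 4 := by exact_mod_cast hk
  nlinarith

/-- **`k₀(7, 33, 11) = 4`** (type `ev3`: `ε = 3`, `r♯ = −26`; `72k ≤ 322` iff `k ≤ 4`: `288 ≤ 322 < 360`) — abc-iut-rh-ref-2's value; the v6 table
entry «5» is NOT a value of the closed form (`k = 5`: `24·15 = 360 > 322`, NEG by 38). [folklore] -/
theorem hexSlice_7_33_11 :
    (∀ k : ℕ, k ≤ 4 → (((5 : ℤ)) ^ 2 - 1) * ((k : ℤ) * 3) ≤ (5 : ℤ) * ((33 : ℤ) - (-26)) + (1 - (-26))) ∧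
      ¬ (((5 : ℤ)) ^ 2 - 1) * ((5 : ℤ) * 3) ≤ (5 : ℤ) * ((33 : ℤ) - (-26)) + (1 - (-26)) := by
  refine ⟨fun k hk => ?_, by norm_num⟩
  have hk' : (k : ℤ) ≤ 4 := by exact_mod_cast hk
  nlinarith

/-- **`k₀(7, 55, 11) = 5`** (type `ev5`: `ε = 5`, `r♯ = −61`; `120k ≤ 642` iff `k ≤ 5`: `600 ≤ 642 < 720`). [folklore] -/
theorem hexSlice_7_55_11 :
    (∀ k : ℕ, k ≤ 5 → (((5 : ℤ)) ^ 2 - 1) * ((k : ℤ) * 5) ≤ (5 : ℤ) * ((55 : ℤ) - (-61)) + (1 - (-61))) ∧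
      ¬ (((5 : ℤ)) ^ 2 - 1) * ((6 : ℤ) * 5) ≤ (5 : ℤ) * ((55 : ℤ) - (-61)) + (1 - (-61)) := by
  refine ⟨fun k hk => ?_, by norm_num⟩
  have hk' : (k : ℤ) ≤ 5 := by exact_mod_cast hk
  nlinarith

/-- **`k₀(7, 66, 11) = 5`** (type `ev6`: `ε = 6`, `r♯ = −83`; `144k ≤ 829` iff `k ≤ 5`: `720 ≤ 829 < 864`). [folklore] -/
theorem hexSlice_7_66_11 :
    (∀ k : ℕ, k ≤ 5 → (((5 : ℤ)) ^ 2 - 1) * ((k : ℤ) * 6) ≤ (5 : ℤ) * ((66 : ℤ) - (-83)) + (1 - (-83))) ∧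
      ¬ (((5 : ℤ)) ^ 2 - 1) * ((6 : ℤ) * 6) ≤ (5 : ℤ) * ((66 : ℤ) - (-83)) + (1 - (-83)) := by
  refine ⟨fun k hk => ?_, by norm_num⟩
  have hk' : (k : ℤ) ≤ 5 := by exact_mod_cast hk
  nlinarith

/-- **`k₀(7, 110, 11) = 6`** (type `ev10`: `ε = 10`, `r♯ = −171`; `240k ≤ 1577` iff `k ≤ 6`: `1440 ≤ 1577 < 1680`). [folklore] -/
theorem hexSlice_7_110_11 :
    (∀ k : ℕ, k ≤ 6 → (((5 : ℤ)) ^ 2 - 1) * ((k : ℤ) * 10) ≤ (5 : ℤ) * ((110 : ℤ) - (-171)) + (1 - (-171))) ∧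
      ¬ (((5 : ℤ)) ^ 2 - 1) * ((7 : ℤ) * 10) ≤ (5 : ℤ) * ((110 : ℤ) - (-171)) + (1 - (-171)) := by
  refine ⟨fun k hk => ?_, by norm_num⟩
  have hk' : (k : ℤ) ≤ 6 := by exact_mod_cast hk
  nlinarith

/-- **`k₀(7, 165, 11) = 6`** (type `ev15`: `ε = 15`, `r♯ = −281`; `360k ≤ 2512` iff `k ≤ 6`: `2160 ≤ 2512 < 2520`) — abc-iut-rh-ref-2's value;
the v6 table entry «7» is NOT a value of the closed form (`k = 7`: `24·105 = 2520 > 2512`, NEG by 8 — the named window cell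
`lamSeven:k=7:l=11@p7.j5.ev15` of abc-iut-lens-wuc-1's DIFF-row8-row15, row 8 NEG / row 15 POS). [folklore] -/
theorem hexSlice_7_165_11 :
    (∀ k : ℕ, k ≤ 6 → (((5 : ℤ)) ^ 2 - 1) * ((k : ℤ) * 15) ≤ (5 : ℤ) * ((165 : ℤ) - (-281)) + (1 - (-281))) ∧
      ¬ (((5 : ℤ)) ^ 2 - 1) * ((7 : ℤ) * 15) ≤ (5 : ℤ) * ((165 : ℤ) - (-281)) + (1 - (-281)) := by
  refine ⟨fun k hk => ?_, by norm_num⟩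
  have hk' : (k : ℤ) ≤ 6 := by exact_mod_cast hk
  nlinarith

/-! ## §L3. The ℝ-valued cell of the typed `HBand` at integer data IS the integer cell -/

/-- **Cast lemma**: for integers `m, e, r` and a label `j`, the real band cell of `RHHeightClass.HBand` / `hBand_iff_cells_of_strictMin`
«`((j:ℝ)² − 1)·m ≤ j·(e − r) + (1 − r)`» holds iff the integer cell does — so the ladder above decides the typed predicate at HEX-type data
(`m_q = k·ε ∈ ℤ` by [IUTchI] Ex. 3.2 (iv), `e_w`, `r♯ ∈ ℤ`). [folklore] -/
theorem bandCell_int_iff (j : ℕ) (m e r : ℤ) :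
    (((j : ℝ)) ^ 2 - 1) * (m : ℝ) ≤ (j : ℝ) * ((e : ℝ) - (r : ℝ)) + (1 - (r : ℝ)) ↔
      (((j : ℤ)) ^ 2 - 1) * m ≤ (j : ℤ) * (e - r) + (1 - r) := by
  constructor
  · intro h
    have h' : ((((((j : ℤ)) ^ 2 - 1) * m : ℤ)) : ℝ) ≤ ((((j : ℤ) * (e - r) + (1 - r) : ℤ)) : ℝ) := by push_cast; exact h
    exact_mod_cast h'
  · intro h
    have h' : ((((((j : ℤ)) ^ 2 - 1) * m : ℤ)) : ℝ) ≤ ((((j : ℤ) * (e - r) + (1 - r) : ℤ)) : ℝ) := by exact_mod_cast h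
    push_cast at h'
    exact h'

end Summit.ABC.IUTFork.Repair.RHHeightClass
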